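import Mathlib.Tactic.NoncommRing
import Literature.LinearAlgebra.TateResidue.FinitePotentTrace
import HarnessLib

/-!
# Tate's abstract residue `res_A(f dg)` and the abstract residue theorem (Tate 1968, §§1–3)

Second layer of J. Tate, *Residues of differentials on curves*, Ann. Sci. ÉNS (4) 1 (1968)
149–159, on top of `FinitePotentTrace` (the trace `Tr_V` of finite-potent operators). For a
subspace `A` of a `K`-vector space `V`:

* `NearlyLE A B` (`A ≼ B`, Tate's `A < B`): `A ⊆ B + W` with `dim W < ∞`; `NearlyLE.bot_iff`.
* Tate's operator classes (§1, Prop. 1) as predicates on `θ : End V`: `InE A θ` (`θA ≼ A`),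
  `InE₁ A θ` (`θV ≼ A`), `InE₂ A θ` (`dim θA < ∞`), `InE₀ = InE₁ ∧ InE₂`; `E` is a subalgebra,
  `E₁, E₂ ⊇ E₀` two-sided ideals with `E₁E₂ + E₂E₁ ⊆ E₀`; every `E₀`-operator is `(A + W)`-small
  (`InE₀.exists_smallOn`), so `Tr_V` is linear on `E₀` (`InE₀.fpTrace_add/sub/smul`), and
  **Prop. 2**: `Tr_V[φ, ψ] = 0` for `φ ∈ E₀, ψ ∈ E` (`InE₀.fpTrace_comm_eq_zero`) or
  `φ ∈ E₁, ψ ∈ E₂` (`InE₁.fpTrace_comm_eq_zero`).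
* **The residue** `res A f g = res_A(f dg) := Tr_V [πf, g]` (`π = proj A` a projection onto `A`;
  §2, Thm. 1 and the Remark after it) and **Theorem 1**: for commuting `f, g ∈ E(A)` it equals
  `Tr_V [f₁, g₁]` for every admissible pair `f₁ ≡ f`, `g₁ ≡ g (mod E₂)`, `f₁ ∈ E₁` or `g₁ ∈ E₁`
  (`fpTrace_comm_eq_res`, `fpTrace_comm_eq_res'`), in particular for any projection onto `A`
  (`res_eq_fpTrace_of_isProj`).
* The rules of §2: **(R1)** bilinearity (`res_add_left/right`, `res_smul_left/right`, …) and
  invariance under isomorphisms (`res_conj`) and direct sums (`res_eq_add_of_isCompl`);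
  **(R2)** `res_A(f dg) = 0` if `fA + fgA + fg²A ⊆ A` (`res_eq_zero_of_map_le`,
  `res_eq_zero_of_invariant`); **(R3)** `res_A(gⁿ dg) = 0` for `n ≥ 0` (`res_pow_self`) and for
  `n ≤ -2` when `g` is invertible (`res_inv_pow`); the **Leibniz rule**
  `res(f d(gh)) = res(fg dh) + res(fh dg)` (`res_mul_right`, replacing Tate's factorisation through
  `Ω¹_{K[f,g]/k}`); **(R4)** `res_A(g⁻¹ dg) = dim_K(A/gA)` when `gA ⊆ A` (`res_inv_eq_finrank`).
* **The abstract residue theorem** `res_eq_zero_of_quasiCompl`: if `B` is an `f, g`-invariant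
  subspace with `dim(A ∩ B) < ∞` and `codim(A + B) < ∞`, then `res_A(f dg) = 0`. This is the
  content of §3, Thm. 3 and its Corollary (`Σ_p res_p ω = 0` on a complete curve, from
  `dim H⁰, dim H¹ < ∞`), i.e. (R5) `res_A + res_B = res_{A+B} + res_{A∩B}` in the only case needed,
  proved directly: with projections adapted to `V = (A ∩ B) ⊕ A₁ ⊕ B₁ ⊕ D`, `π_A + π_B - 1` has
  finite rank, and `[π_B f, g]² = 0`.

Downstream (`Literature.NumberTheory.DiophantineGeometry.FunctionFieldResidues*`): `V` = adeles of
a function field `F/K`, `A = 𝔸(0)`, `B = F`: the residue theorem, local residues at rational places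
(§3, Thm. 2: `res_p(f dg) = coeff_{t⁻¹}(f g')`, via (R2)–(R4) and the Leibniz rule), the Weil
differential `dx` with its explicit divisor, and the Riemann–Hurwitz / canonical-divisor formula
in characteristic `0`.

All declarations are new (Mathlib v4.32.0 has no Tate residue; searched `residue`, `Tate` in
`LinearAlgebra`, `RingTheory`), in `namespace Literature.Tate`. Mathlib anchors: `LinearMap.IsProj`,
`Submodule.projection`, `Submodule.prodEquivOfIsCompl`, `Submodule.quotientEquivOfIsCompl`,
`LinearEquiv.conj`, `Mathlib.Tactic.NoncommRing`.

## References

* J. Tate, *Residues of differentials on curves*, Ann. Sci. École Norm. Sup. (4) 1 (1968),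
  149–159, §1 Prop. 1–2, §2 Thm. 1, (R1)–(R5), §3 Thm. 3. [Tate1968]
-/

noncomputable section

open Module LinearMap Submodule

namespace Literature.LinearAlgebra.TateResidue.Tate

universe u v

variable {K : Type u} {V : Type v} [Field K] [AddCommGroup V] [Module K V]

/-! ### `A ≼ B`: "not much bigger than" -/

/-- Tate's relation `A ≺ B` ("`A` is not much bigger than `B`"): `A ⊆ B + W` for some
finite-dimensional `W`, equivalently `(A + B)/B` is finite-dimensional (Tate 1968, §1).
[cite: Tate1968, §1] -/
def NearlyLE (A B : Submodule K V) : Prop :=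
  ∃ W : Submodule K V, FiniteDimensional K W ∧ A ≤ B ⊔ W

namespace NearlyLE

variable {A B C A' B' : Submodule K V}

/-- `A ⊆ B` implies `A ≼ B`. [folklore] -/
theorem of_le (h : A ≤ B) : NearlyLE A B := ⟨⊥, inferInstance, by simpa using h⟩

/-- `≼` is reflexive. [folklore] -/
theorem refl (A : Submodule K V) : NearlyLE A A := of_le le_rfl

/-- A finite-dimensional subspace is `≼` anything. [folklore] -/
theorem of_finiteDimensional [FiniteDimensional K A] (B : Submodule K V) : NearlyLE A B :=
  ⟨A, inferInstance, le_sup_right⟩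

/-- `≼` is transitive (Tate 1968, §1). [cite: Tate1968, §1] -/
theorem trans (h₁ : NearlyLE A B) (h₂ : NearlyLE B C) : NearlyLE A C := by
  obtain ⟨W₁, _, h₁⟩ := h₁
  obtain ⟨W₂, _, h₂⟩ := h₂
  refine ⟨W₁ ⊔ W₂, inferInstance, h₁.trans ?_⟩
  calc B ⊔ W₁ ≤ (C ⊔ W₂) ⊔ W₁ := sup_le_sup_right h₂ _
    _ = C ⊔ (W₁ ⊔ W₂) := by rw [sup_assoc, sup_comm W₂]

/-- `≼` is monotone. [folklore] -/
theorem mono (h : NearlyLE A B) (hA : A' ≤ A) (hB : B ≤ B') : NearlyLE A' B' := by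
  obtain ⟨W, _, h⟩ := h
  exact ⟨W, inferInstance, hA.trans (h.trans (sup_le_sup_right hB _))⟩

/-- `≼` is antitone on the left. [folklore] -/
theorem mono_left (h : NearlyLE A B) (hA : A' ≤ A) : NearlyLE A' B := h.mono hA le_rfl

/-- `≼` is monotone on the right. [folklore] -/
theorem mono_right (h : NearlyLE A B) (hB : B ≤ B') : NearlyLE A B' := h.mono le_rfl hB

/-- `Σ Aᵢ ≼ B` if each `Aᵢ ≼ B` (Tate 1968, §1). [cite: Tate1968, §1] -/
theorem sup (h₁ : NearlyLE A B) (h₂ : NearlyLE A' B) : NearlyLE (A ⊔ A') B := by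
  obtain ⟨W₁, _, h₁⟩ := h₁
  obtain ⟨W₂, _, h₂⟩ := h₂
  refine ⟨W₁ ⊔ W₂, inferInstance, sup_le (h₁.trans ?_) (h₂.trans ?_)⟩
  · exact sup_le_sup_left le_sup_left _
  · exact sup_le_sup_left le_sup_right _

/-- `A ≼ B ⟹ θA ≼ θB` (Tate 1968, §1). [cite: Tate1968, §1] -/
theorem map (h : NearlyLE A B) (θ : Module.End K V) : NearlyLE (A.map θ) (B.map θ) := by
  obtain ⟨W, _, h⟩ := h
  exact ⟨W.map θ, inferInstance, (Submodule.map_mono h).trans (by rw [Submodule.map_sup])⟩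

/-- `A ≺ 0` iff `A` is finite-dimensional. [cite: Tate1968, §1] -/
theorem bot_iff : NearlyLE A ⊥ ↔ FiniteDimensional K A := by
  refine ⟨fun ⟨W, _, h⟩ ↦ ?_, fun _ ↦ of_finiteDimensional ⊥⟩
  rw [bot_sup_eq] at h
  exact Submodule.finiteDimensional_of_le h

/-- `A ≺ 0` means `A` is finite-dimensional. [cite: Tate1968, §1] -/
theorem finiteDimensional (h : NearlyLE A ⊥) : FiniteDimensional K A := bot_iff.1 h

section map

variable {V' : Type*} [AddCommGroup V'] [Module K V']

/-- `A ≼ B ⟹ φA ≼ φB` for any linear map `φ : V → V'`. [cite: Tate1968, §1] -/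
theorem map' (h : NearlyLE A B) (φ : V →ₗ[K] V') : NearlyLE (A.map φ) (B.map φ) := by
  obtain ⟨W, _, h⟩ := h
  exact ⟨W.map φ, inferInstance, (Submodule.map_mono h).trans (by rw [Submodule.map_sup])⟩

end map

/-- If `S ⊆ T` and `T/S` is finite-dimensional — witnessed by a linear map `φ` on `T` with
finite-dimensional range whose kernel lies in `S` — then `T ≼ S`. [folklore] -/
theorem of_linearMap_ker_le {S T : Submodule K V} {N : Type*} [AddCommGroup N] [Module K N]
    [FiniteDimensional K N] (φ : T →ₗ[K] N) (hker : ∀ x : T, φ x = 0 → (x : V) ∈ S) :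
    NearlyLE T S := by
  obtain ⟨C, hC⟩ := (LinearMap.ker φ).exists_isCompl
  haveI : FiniteDimensional K C := by
    have e := (Submodule.quotientEquivOfIsCompl _ C hC).symm.trans (LinearMap.quotKerEquivRange φ)
    exact LinearEquiv.finiteDimensional e.symm
  refine ⟨C.map T.subtype, inferInstance, fun t ht ↦ ?_⟩
  have : (⟨t, ht⟩ : T) ∈ LinearMap.ker φ ⊔ C := by rw [hC.sup_eq_top]; trivial
  obtain ⟨k, hk, c, hc, hkc⟩ := Submodule.mem_sup.1 this
  have hkc' : (k : V) + c = t := by simpa using congrArg Subtype.val hkc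
  rw [← hkc']
  exact Submodule.add_mem_sup (hker k hk) ⟨c, hc, rfl⟩

/-- A subspace of finite codimension is `≽ V`. [folklore] -/
theorem top_of_finiteDimensional_quotient (S : Submodule K V) [FiniteDimensional K (V ⧸ S)] :
    NearlyLE ⊤ S := by
  have h : NearlyLE (⊤ : Submodule K V) (S.comap (⊤ : Submodule K V).subtype |>.map (⊤ : Submodule K V).subtype) :=
    (of_linearMap_ker_le (S := S.comap (⊤ : Submodule K V).subtype |>.map (⊤ : Submodule K V).subtype)
      (T := ⊤) (S.mkQ ∘ₗ (⊤ : Submodule K V).subtype) fun x hx ↦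
        ⟨x, by simpa [LinearMap.mem_ker] using hx, rfl⟩)
  exact h.mono_right (Submodule.map_le_iff_le_comap.2 le_rfl)

end NearlyLE

/-! ### Tate's operator classes `E ⊇ E₁, E₂ ⊇ E₀ = E₁ ∩ E₂` attached to a subspace `A` -/

section E

variable (A : Submodule K V)

/-- `θ ∈ E(A)`: `θA ≺ A` (Tate 1968, §1). [cite: Tate1968, §1, Prop. 1] -/
def InE (θ : Module.End K V) : Prop := NearlyLE (A.map θ) A

/-- `θ ∈ E₁(A)`: `θV ≺ A` (Tate 1968, §1). [cite: Tate1968, §1, Prop. 1] -/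
def InE₁ (θ : Module.End K V) : Prop := NearlyLE (range θ) A

/-- `θ ∈ E₂(A)`: `θA ≺ 0`, i.e. `θA` is finite-dimensional (Tate 1968, §1). [cite: Tate1968, §1, Prop. 1] -/
def InE₂ (θ : Module.End K V) : Prop := FiniteDimensional K (A.map θ)

/-- `θ ∈ E₀(A) = E₁(A) ∩ E₂(A)`: the finite-potent ("trace class") operators of Tate 1968, §1.
[cite: Tate1968, §1, Prop. 1] -/
def InE₀ (θ : Module.End K V) : Prop := InE₁ A θ ∧ InE₂ A θ

variable {A} {θ θ₁ θ₂ ψ : Module.End K V}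

/-- `E₁ ⊆ E`. [cite: Tate1968, §1, Prop. 1] -/
theorem InE₁.inE (h : InE₁ A θ) : InE A θ := NearlyLE.mono_left h LinearMap.map_le_range

/-- `E₂ ⊆ E`. [cite: Tate1968, §1, Prop. 1] -/
theorem InE₂.inE (h : InE₂ A θ) : InE A θ := by
  haveI : FiniteDimensional K (A.map θ) := h
  exact NearlyLE.of_finiteDimensional A

/-- `E₀ ⊆ E₁`. [cite: Tate1968, §1, Prop. 1] -/
theorem InE₀.inE₁ (h : InE₀ A θ) : InE₁ A θ := h.1
/-- `E₀ ⊆ E₂`. [cite: Tate1968, §1, Prop. 1] -/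
theorem InE₀.inE₂ (h : InE₀ A θ) : InE₂ A θ := h.2
/-- `E₀ ⊆ E`. [cite: Tate1968, §1, Prop. 1] -/
theorem InE₀.inE (h : InE₀ A θ) : InE A θ := h.1.inE

/-- `1 ∈ E`. [folklore] -/
theorem inE_one : InE A (1 : Module.End K V) := NearlyLE.of_le (by simp [Module.End.one_eq_id])

/-- `id ∈ E`. [folklore] -/
theorem inE_id : InE A (LinearMap.id : Module.End K V) := NearlyLE.of_le (by simp)

/-- An operator preserving `A` lies in `E(A)`. [folklore] -/
theorem inE_of_map_le (h : A.map θ ≤ A) : InE A θ := NearlyLE.of_le h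

/-- `E` is closed under `+`. [cite: Tate1968, §1, Prop. 1] -/
theorem InE.add (h₁ : InE A θ₁) (h₂ : InE A θ₂) : InE A (θ₁ + θ₂) :=
  (h₁.sup h₂).mono_left (Submodule.map_add_le _ _ _)

/-- `E` is closed under scalars. [cite: Tate1968, §1, Prop. 1] -/
theorem InE.smul (c : K) (h : InE A θ) : InE A (c • θ) := h.mono_left (map_smul_le' c θ A)

/-- `E` is closed under negation. [cite: Tate1968, §1, Prop. 1] -/
theorem InE.neg (h : InE A θ) : InE A (-θ) := by simpa using h.smul (-1)

/-- `E` is closed under `-`. [cite: Tate1968, §1, Prop. 1] -/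
theorem InE.sub (h₁ : InE A θ₁) (h₂ : InE A θ₂) : InE A (θ₁ - θ₂) := by
  simpa [sub_eq_add_neg] using h₁.add h₂.neg

/-- `E` is a subalgebra (Tate 1968, §1, Prop. 1). [cite: Tate1968, §1, Prop. 1] -/
theorem InE.mul (h₁ : InE A θ₁) (h₂ : InE A θ₂) : InE A (θ₁ * θ₂) := by
  have : NearlyLE ((A.map θ₂).map θ₁) (A.map θ₁) := h₂.map θ₁
  rw [InE, Module.End.mul_eq_comp, Submodule.map_comp]
  exact this.trans h₁

/-- `E` is closed under powers. [cite: Tate1968, §1, Prop. 1] -/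
theorem InE.pow (h : InE A θ) (n : ℕ) : InE A (θ ^ n) := by
  induction n with
  | zero => rw [pow_zero]; exact inE_one
  | succ n ih => rw [pow_succ]; exact ih.mul h

/-- `E₁` is closed under `+`. [cite: Tate1968, §1, Prop. 1] -/
theorem InE₁.add (h₁ : InE₁ A θ₁) (h₂ : InE₁ A θ₂) : InE₁ A (θ₁ + θ₂) := by
  refine (h₁.sup h₂).mono_left ?_
  rw [range_eq_map, range_eq_map, range_eq_map]
  exact Submodule.map_add_le _ _ _

/-- `E₁` is closed under scalars. [cite: Tate1968, §1, Prop. 1] -/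
theorem InE₁.smul (c : K) (h : InE₁ A θ) : InE₁ A (c • θ) := by
  refine h.mono_left ?_
  rintro _ ⟨y, rfl⟩
  exact Submodule.smul_mem _ c (mem_range_self θ y)

/-- `E₁` is closed under negation. [cite: Tate1968, §1, Prop. 1] -/
theorem InE₁.neg (h : InE₁ A θ) : InE₁ A (-θ) := by simpa using h.smul (-1)

/-- `E₁` is closed under `-`. [cite: Tate1968, §1, Prop. 1] -/
theorem InE₁.sub (h₁ : InE₁ A θ₁) (h₂ : InE₁ A θ₂) : InE₁ A (θ₁ - θ₂) := by
  simpa [sub_eq_add_neg] using h₁.add h₂.neg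

/-- `E₁` is a left ideal in `E`. [cite: Tate1968, §1, Prop. 1] -/
theorem InE₁.mul_left (h : InE₁ A θ) (hψ : InE A ψ) : InE₁ A (ψ * θ) := by
  have : NearlyLE ((range θ).map ψ) (A.map ψ) := h.map ψ
  rw [InE₁, Module.End.mul_eq_comp, range_comp]
  exact this.trans hψ

/-- `E₁` is a right ideal (even in `End V`). [cite: Tate1968, §1, Prop. 1] -/
theorem InE₁.mul_right (h : InE₁ A θ) (ψ : Module.End K V) : InE₁ A (θ * ψ) :=
  h.mono_left (range_comp_le_range _ _)

/-- For `θ ∈ E₂(A)`, `θA` is finite-dimensional. [cite: Tate1968, §1, Prop. 1] -/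
theorem InE₂.finiteDimensional (h : InE₂ A θ) : FiniteDimensional K (A.map θ) := h

/-- `E₂` is closed under `+`. [cite: Tate1968, §1, Prop. 1] -/
theorem InE₂.add (h₁ : InE₂ A θ₁) (h₂ : InE₂ A θ₂) : InE₂ A (θ₁ + θ₂) := by
  haveI := h₁.finiteDimensional; haveI := h₂.finiteDimensional
  exact Submodule.finiteDimensional_of_le (Submodule.map_add_le _ _ _)

/-- `E₂` is closed under scalars. [cite: Tate1968, §1, Prop. 1] -/
theorem InE₂.smul (c : K) (h : InE₂ A θ) : InE₂ A (c • θ) := by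
  haveI := h.finiteDimensional
  exact Submodule.finiteDimensional_of_le (map_smul_le' c θ A)

/-- `E₂` is closed under negation. [cite: Tate1968, §1, Prop. 1] -/
theorem InE₂.neg (h : InE₂ A θ) : InE₂ A (-θ) := by simpa using h.smul (-1)

/-- `E₂` is closed under `-`. [cite: Tate1968, §1, Prop. 1] -/
theorem InE₂.sub (h₁ : InE₂ A θ₁) (h₂ : InE₂ A θ₂) : InE₂ A (θ₁ - θ₂) := by
  simpa [sub_eq_add_neg] using h₁.add h₂.neg

/-- `E₂` is a left ideal (even in `End V`). [cite: Tate1968, §1, Prop. 1] -/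
theorem InE₂.mul_left (h : InE₂ A θ) (ψ : Module.End K V) : InE₂ A (ψ * θ) := by
  haveI := h.finiteDimensional
  rw [InE₂, Module.End.mul_eq_comp, Submodule.map_comp]; infer_instance

/-- `E₂` is a right ideal in `E`. [cite: Tate1968, §1, Prop. 1] -/
theorem InE₂.mul_right (h : InE₂ A θ) (hψ : InE A ψ) : InE₂ A (θ * ψ) := by
  haveI := h.finiteDimensional
  obtain ⟨W, _, hW⟩ := hψ
  rw [InE₂, Module.End.mul_eq_comp, Submodule.map_comp]
  have hle : (A.map ψ).map θ ≤ A.map θ ⊔ W.map θ :=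
    (Submodule.map_mono hW).trans (by rw [Submodule.map_sup])
  exact Submodule.finiteDimensional_of_le hle

/-- `E₀` is closed under `+`. [cite: Tate1968, §1, Prop. 1] -/
theorem InE₀.add (h₁ : InE₀ A θ₁) (h₂ : InE₀ A θ₂) : InE₀ A (θ₁ + θ₂) :=
  ⟨h₁.1.add h₂.1, h₁.2.add h₂.2⟩

/-- `E₀` is closed under `-`. [cite: Tate1968, §1, Prop. 1] -/
theorem InE₀.sub (h₁ : InE₀ A θ₁) (h₂ : InE₀ A θ₂) : InE₀ A (θ₁ - θ₂) :=
  ⟨h₁.1.sub h₂.1, h₁.2.sub h₂.2⟩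

/-- `E₀` is closed under scalars. [cite: Tate1968, §1, Prop. 1] -/
theorem InE₀.smul (c : K) (h : InE₀ A θ) : InE₀ A (c • θ) := ⟨h.1.smul c, h.2.smul c⟩

/-- `E₀` is a two-sided ideal in `E`. [cite: Tate1968, §1, Prop. 1] -/
theorem InE₀.mul_left (h : InE₀ A θ) (hψ : InE A ψ) : InE₀ A (ψ * θ) :=
  ⟨h.1.mul_left hψ, h.2.mul_left ψ⟩

/-- `E₀` is a right ideal in `E`. [cite: Tate1968, §1, Prop. 1] -/
theorem InE₀.mul_right (h : InE₀ A θ) (hψ : InE A ψ) : InE₀ A (θ * ψ) :=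
  ⟨h.1.mul_right ψ, h.2.mul_right hψ⟩

/-- `E₁ · E₂ ⊆ E₀`. [cite: Tate1968, §1, Prop. 1] -/
theorem InE₁.mul_inE₂ (h₁ : InE₁ A θ₁) (h₂ : InE₂ A θ₂) : InE₀ A (θ₁ * θ₂) :=
  ⟨h₁.mul_right θ₂, h₂.mul_left θ₁⟩

/-- `E₂ · E₁ ⊆ E₀`. [cite: Tate1968, §1, Prop. 1] -/
theorem InE₂.mul_inE₁ (h₂ : InE₂ A θ₂) (h₁ : InE₁ A θ₁) : InE₀ A (θ₂ * θ₁) :=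
  ⟨h₁.mul_left h₂.inE, h₂.mul_right h₁.inE⟩

/-- An operator of finite rank lies in `E₀`. [folklore] -/
theorem inE₀_of_finiteDimensional_range [FiniteDimensional K (range θ)] : InE₀ A θ :=
  ⟨NearlyLE.of_finiteDimensional A, Submodule.finiteDimensional_of_le LinearMap.map_le_range⟩

/-- `0 ∈ E₂(A)`. [folklore] -/
theorem inE₂_zero : InE₂ A (0 : Module.End K V) := by
  rw [InE₂, Submodule.map_zero]; infer_instance

/-- `0 ∈ E₀(A)`. [folklore] -/
theorem inE₀_zero : InE₀ A (0 : Module.End K V) :=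
  ⟨NearlyLE.of_le (by rw [LinearMap.range_zero]; exact bot_le), inE₂_zero⟩

/-! ### `E₀`-operators are `U`-small -/

/-- An `E₀(A)`-operator is `(A + W)`-small for some finite-dimensional `W`. [cite: Tate1968, §1, Prop. 1] -/
theorem InE₀.exists_smallOn (h : InE₀ A θ) :
    ∃ W : Submodule K V, FiniteDimensional K W ∧ SmallOn (A ⊔ W) θ := by
  obtain ⟨⟨W, hW, hle⟩, h₂⟩ := h
  haveI := h₂.finiteDimensional
  refine ⟨W, hW, hle, ?_⟩
  rw [Submodule.map_sup]; infer_instance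

/-- Enlarging the finite-dimensional part keeps an `E₀`-operator small. [folklore] -/
theorem SmallOn.sup_of_le {W W' : Submodule K V} [FiniteDimensional K W'] (h : SmallOn (A ⊔ W) θ)
    (h₂ : InE₂ A θ) (hW : W ≤ W') : SmallOn (A ⊔ W') θ := by
  haveI := h₂.finiteDimensional
  refine ⟨h.range_le.trans (sup_le_sup_left hW _), ?_⟩
  rw [Submodule.map_sup]; infer_instance

/-- An `E₀(A)`-operator is `(A + W')`-small for every finite-dimensional `W'` containing its
chosen witness. [folklore] -/
theorem InE₀.smallOn_of_le (h : InE₀ A θ) {W' : Submodule K V} [FiniteDimensional K W']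
    (hW : h.exists_smallOn.choose ≤ W') : SmallOn (A ⊔ W') θ :=
  haveI := h.exists_smallOn.choose_spec.1
  h.exists_smallOn.choose_spec.2.sup_of_le h.2 hW

/-- Two `E₀(A)`-operators are simultaneously `U`-small. [folklore] -/
theorem InE₀.exists_smallOn₂ (h₁ : InE₀ A θ₁) (h₂ : InE₀ A θ₂) :
    ∃ U : Submodule K V, SmallOn U θ₁ ∧ SmallOn U θ₂ := by
  haveI := h₁.exists_smallOn.choose_spec.1
  haveI := h₂.exists_smallOn.choose_spec.1
  exact ⟨A ⊔ (h₁.exists_smallOn.choose ⊔ h₂.exists_smallOn.choose),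
    h₁.smallOn_of_le le_sup_left, h₂.smallOn_of_le le_sup_right⟩

/-- Three `E₀(A)`-operators are simultaneously `U`-small. [folklore] -/
theorem InE₀.exists_smallOn₃ {θ₃ : Module.End K V} (h₁ : InE₀ A θ₁) (h₂ : InE₀ A θ₂)
    (h₃ : InE₀ A θ₃) : ∃ U : Submodule K V, SmallOn U θ₁ ∧ SmallOn U θ₂ ∧ SmallOn U θ₃ := by
  haveI := h₁.exists_smallOn.choose_spec.1
  haveI := h₂.exists_smallOn.choose_spec.1
  haveI := h₃.exists_smallOn.choose_spec.1
  exact ⟨A ⊔ (h₁.exists_smallOn.choose ⊔ h₂.exists_smallOn.choose ⊔ h₃.exists_smallOn.choose),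
    h₁.smallOn_of_le (le_sup_left.trans le_sup_left), h₂.smallOn_of_le (le_sup_right.trans le_sup_left),
    h₃.smallOn_of_le le_sup_right⟩

/-- `E₀` is finite-potent (Tate 1968, §1, Prop. 1). [cite: Tate1968, §1, Prop. 1] -/
theorem InE₀.isFinitePotent (h : InE₀ A θ) : IsFinitePotent θ :=
  h.exists_smallOn.choose_spec.2.isFinitePotent

/-- `Tr_V` is additive on `E₀(A)` (Tate 1968, §1, (T4) with Prop. 1). [cite: Tate1968, §1, Prop. 1] -/
theorem InE₀.fpTrace_add (h₁ : InE₀ A θ₁) (h₂ : InE₀ A θ₂) :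
    fpTrace (θ₁ + θ₂) = fpTrace θ₁ + fpTrace θ₂ := by
  obtain ⟨U, hU₁, hU₂⟩ := h₁.exists_smallOn₂ h₂
  exact hU₁.fpTrace_add hU₂

/-- `Tr_V` is subtractive on `E₀(A)`. [cite: Tate1968, §1, Prop. 1] -/
theorem InE₀.fpTrace_sub (h₁ : InE₀ A θ₁) (h₂ : InE₀ A θ₂) :
    fpTrace (θ₁ - θ₂) = fpTrace θ₁ - fpTrace θ₂ := by
  obtain ⟨U, hU₁, hU₂⟩ := h₁.exists_smallOn₂ h₂
  exact hU₁.fpTrace_sub hU₂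

/-- `Tr_V` is homogeneous on `E₀(A)`. [cite: Tate1968, §1, Prop. 1] -/
theorem InE₀.fpTrace_smul (c : K) (h : InE₀ A θ) : fpTrace (c • θ) = c * fpTrace θ :=
  h.exists_smallOn.choose_spec.2.fpTrace_smul c

/-! ### Proposition 2: commutators with zero trace -/

/-- **Tate's Prop. 2, first case**: for `φ ∈ E₀` and `ψ ∈ E` the commutator `[φ, ψ] ∈ E₀` has trace
zero. [cite: Tate1968, §1, Prop. 2] -/
theorem InE₀.fpTrace_comm_eq_zero (hφ : InE₀ A θ) (hψ : InE A ψ) :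
    fpTrace (θ * ψ - ψ * θ) = 0 := by
  rw [(hφ.mul_right hψ).fpTrace_sub (hφ.mul_left hψ), Literature.LinearAlgebra.TateResidue.Tate.fpTrace_mul_comm, sub_self]
  exact (hφ.mul_left hψ).isFinitePotent

/-- **Tate's Prop. 2, second case**: for `φ ∈ E₁` and `ψ ∈ E₂` the commutator `[φ, ψ] ∈ E₀` has trace
zero. [cite: Tate1968, §1, Prop. 2] -/
theorem InE₁.fpTrace_comm_eq_zero (hφ : InE₁ A θ) (hψ : InE₂ A ψ) :
    fpTrace (θ * ψ - ψ * θ) = 0 := by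
  have hfin : FiniteDimensional K (range (ψ * θ)) := by
    haveI := hψ.finiteDimensional
    obtain ⟨W, _, hW⟩ := hφ
    rw [Module.End.mul_eq_comp, range_comp]
    have hle : (range θ).map ψ ≤ A.map ψ ⊔ W.map ψ :=
      (Submodule.map_mono hW).trans (by rw [Submodule.map_sup])
    exact Submodule.finiteDimensional_of_le hle
  rw [(hφ.mul_inE₂ hψ).fpTrace_sub (hψ.mul_inE₁ hφ), Literature.LinearAlgebra.TateResidue.Tate.fpTrace_mul_comm, sub_self]
  exact IsFinitePotent.of_finiteDimensional_range _

/-- `Tr_V(-θ) = -Tr_V θ` on `E₀`. [folklore] -/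
theorem InE₀.fpTrace_neg (h : InE₀ A θ) : fpTrace (-θ) = -fpTrace θ := by
  simpa using h.fpTrace_smul (-1)

/-- Prop. 2, first case, with the commutator in the other order. [cite: Tate1968, §1, Prop. 2] -/
theorem InE₀.fpTrace_comm_eq_zero' (hφ : InE₀ A θ) (hψ : InE A ψ) :
    fpTrace (ψ * θ - θ * ψ) = 0 := by
  rw [← neg_sub, (hφ.mul_right hψ).sub (hφ.mul_left hψ) |>.fpTrace_neg, hφ.fpTrace_comm_eq_zero hψ,
    neg_zero]

/-! ### The key membership: `[q, g₁] ∈ E₀` for `q ≡ f`, `g₁ ≡ g (mod E₂)`, `q ∈ E₁`, `fg = gf` -/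

variable {f g q g₁ : Module.End K V}

/-- If `q ∈ E₁`, `q ≡ f (mod E₂)`, `g ∈ E` and `fg = gf`, then `[q, g] ∈ E₀` (Tate 1968, proof of
Thm. 1). [cite: Tate1968, §2, Thm. 1] -/
theorem inE₀_comm (hq₁ : InE₁ A q) (hq₂ : InE₂ A (q - f)) (hg : InE A g) (hfg : Commute f g) :
    InE₀ A (q * g - g * q) := by
  refine ⟨(hq₁.mul_right g).sub (hq₁.mul_left hg), ?_⟩
  have : q * g - g * q = (q - f) * g - g * (q - f) := by
    have h := hfg.eq
    calc q * g - g * q = (q - f) * g - g * (q - f) + (f * g - g * f) := by noncomm_ring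
      _ = (q - f) * g - g * (q - f) := by rw [h, sub_self, add_zero]
  rw [this]
  exact (hq₂.mul_right hg).sub (hq₂.mul_left g)

/-- Same with `g` replaced by any `g₁ ≡ g (mod E₂)`. [cite: Tate1968, §2, Thm. 1] -/
theorem inE₀_comm' (hq₁ : InE₁ A q) (hq₂ : InE₂ A (q - f)) (hg : InE A g) (hfg : Commute f g)
    (hg₁ : InE₂ A (g₁ - g)) : InE₀ A (q * g₁ - g₁ * q) := by
  have : q * g₁ - g₁ * q = (q * g - g * q) + (q * (g₁ - g) - (g₁ - g) * q) := by noncomm_ring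
  rw [this]
  exact (inE₀_comm hq₁ hq₂ hg hfg).add ((hq₁.mul_inE₂ hg₁).sub (hg₁.mul_inE₁ hq₁))

end E

/-! ### Projections onto `A` and the residue -/

section res

variable (A : Submodule K V)

/-- A chosen `K`-linear projection of `V` onto `A` (along a chosen complement). [folklore] -/
def proj : Module.End K V :=
  A.projection A.exists_isCompl.choose A.exists_isCompl.choose_spec

/-- `proj A` is a projection onto `A`. [folklore] -/
theorem isProj_proj : LinearMap.IsProj A (proj A) :=
  ⟨fun x ↦ Submodule.projection_apply_mem _ x, fun _ hx ↦ Submodule.projection_apply_of_mem_left _ hx⟩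

/-- **Tate's residue** `res_A(f dg) := Tr_V([πf, g])` for a projection `π` of `V` onto `A`
(Tate 1968, §2, Thm. 1 and the Remark following it, with `f₁ = πf`, `g₁ = g`). It is independent
of `π` and more generally equals `Tr_V [f₁, g₁]` for every admissible pair
(`fpTrace_comm_eq_res`); it is meaningful for commuting `f, g ∈ E(A)`. [cite: Tate1968, §2, Thm. 1] -/
def res (f g : Module.End K V) : K :=
  fpTrace (proj A * f * g - g * (proj A * f))

variable {A} {p f g f' g' h : Module.End K V}


/-- For a projection `p` onto `A` and any `f`: `pf ∈ E₁(A)`. [folklore] -/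
theorem inE₁_proj_mul (hp : LinearMap.IsProj A p) (f : Module.End K V) : InE₁ A (p * f) :=
  NearlyLE.of_le ((range_comp_le_range _ _).trans fun _ ⟨y, hy⟩ ↦ hy ▸ hp.map_mem y)

/-- A projection onto `A` lies in `E₁(A)`. [folklore] -/
theorem inE₁_proj (hp : LinearMap.IsProj A p) : InE₁ A p :=
  NearlyLE.of_le fun _ ⟨y, hy⟩ ↦ hy ▸ hp.map_mem y

/-- A projection onto `A` lies in `E(A)`. [folklore] -/
theorem inE_proj (hp : LinearMap.IsProj A p) : InE A p := (inE₁_proj hp).inE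

/-- For a projection `p` onto `A` and `f ∈ E(A)`: `pf ≡ f (mod E₂(A))` (Tate 1968, §2, remark after
Thm. 1: "`πf ∈ E₁` and `πf ≡ f (mod E₂)`"). [cite: Tate1968, §2, Thm. 1] -/
theorem inE₂_proj_mul_sub (hp : LinearMap.IsProj A p) (hf : InE A f) : InE₂ A (p * f - f) := by
  obtain ⟨W, hW, hle⟩ := hf
  refine Submodule.finiteDimensional_of_le (S₂ := W.map (p - 1)) ?_
  rintro _ ⟨a, ha, rfl⟩
  obtain ⟨a', ha', w, hw, hsum⟩ := Submodule.mem_sup.1 (hle (Submodule.mem_map_of_mem ha))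
  refine ⟨w, hw, ?_⟩
  simp only [LinearMap.sub_apply, Module.End.mul_apply, Module.End.one_apply, ← hsum, map_add,
    hp.map_id a' ha']
  abel

/-- `p - 1 ∈ E₂(A)` for a projection `p` onto `A`. [folklore] -/
theorem inE₂_proj_sub_one (hp : LinearMap.IsProj A p) : InE₂ A (p - 1) := by
  refine Submodule.finiteDimensional_of_le (S₂ := ⊥) ?_
  rintro _ ⟨a, ha, rfl⟩
  simp [hp.map_id a ha]


/-- **Tate's Theorem 1** (well-definedness of the residue): for commuting `f, g ∈ E(A)` and any
`f₁ ∈ E₁` with `f₁ ≡ f`, `g₁ ≡ g (mod E₂)`, the commutator `[f₁, g₁]` lies in `E₀` and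
`Tr_V [f₁, g₁] = res_A(f dg)` (Tate 1968, §2, Thm. 1, conditions (a), (b) with `f₁ ∈ E₁`).
[cite: Tate1968, §2, Thm. 1] -/
theorem fpTrace_comm_eq_res (hf : InE A f) (hg : InE A g) (hfg : Commute f g)
    {f₁ g₁ : Module.End K V} (hf₁ : InE₁ A f₁) (hf₁' : InE₂ A (f₁ - f)) (hg₁ : InE₂ A (g₁ - g)) :
    fpTrace (f₁ * g₁ - g₁ * f₁) = res A f g := by
  set p := proj A
  have hp := isProj_proj A
  have hq₁ : InE₁ A (p * f) := inE₁_proj_mul hp f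
  have hq₂ : InE₂ A (p * f - f) := inE₂_proj_mul_sub hp hf
  -- the three pieces
  have hX : InE₀ A (p * f * g - g * (p * f)) := inE₀_comm hq₁ hq₂ hg hfg
  have hφ : InE₀ A (f₁ - p * f) := by
    refine ⟨hf₁.sub hq₁, ?_⟩
    have : f₁ - p * f = (f₁ - f) - (p * f - f) := by abel
    rw [this]; exact hf₁'.sub hq₂
  have hg₁E : InE A g₁ := by simpa using hg₁.inE.add hg
  have hY : InE₀ A ((f₁ - p * f) * g₁ - g₁ * (f₁ - p * f)) :=
    (hφ.mul_right hg₁E).sub (hφ.mul_left hg₁E)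
  have hZ : InE₀ A (p * f * (g₁ - g) - (g₁ - g) * (p * f)) :=
    (hq₁.mul_inE₂ hg₁).sub (hg₁.mul_inE₁ hq₁)
  have hsplit : f₁ * g₁ - g₁ * f₁ = (p * f * g - g * (p * f)) +
      ((f₁ - p * f) * g₁ - g₁ * (f₁ - p * f)) + (p * f * (g₁ - g) - (g₁ - g) * (p * f)) := by
    noncomm_ring
  rw [hsplit, (hX.add hY).fpTrace_add hZ, hX.fpTrace_add hY, hφ.fpTrace_comm_eq_zero hg₁E,
    hq₁.fpTrace_comm_eq_zero hg₁, add_zero, add_zero]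
  rfl

/-- **Tate's Theorem 1**, condition (b) in the form `g₁ ∈ E₁`. [cite: Tate1968, §2, Thm. 1] -/
theorem fpTrace_comm_eq_res' (hf : InE A f) (hg : InE A g) (hfg : Commute f g)
    {f₁ g₁ : Module.End K V} (hg₁ : InE₁ A g₁) (hf₁' : InE₂ A (f₁ - f)) (hg₁' : InE₂ A (g₁ - g)) :
    fpTrace (f₁ * g₁ - g₁ * f₁) = res A f g := by
  set p := proj A
  have hp := isProj_proj A
  have hq₁ : InE₁ A (p * f) := inE₁_proj_mul hp f
  have hq₂ : InE₂ A (p * f - f) := inE₂_proj_mul_sub hp hf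
  rw [← fpTrace_comm_eq_res hf hg hfg hq₁ hq₂ hg₁']
  have hX' : InE₀ A (p * f * g₁ - g₁ * (p * f)) := inE₀_comm' hq₁ hq₂ hg hfg hg₁'
  have hψ : InE₂ A (f₁ - p * f) := by
    have : f₁ - p * f = (f₁ - f) - (p * f - f) := by abel
    rw [this]; exact hf₁'.sub hq₂
  have hY' : InE₀ A ((f₁ - p * f) * g₁ - g₁ * (f₁ - p * f)) :=
    (hψ.mul_inE₁ hg₁).sub (hg₁.mul_inE₂ hψ)
  have hsplit : f₁ * g₁ - g₁ * f₁ =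
      (p * f * g₁ - g₁ * (p * f)) + ((f₁ - p * f) * g₁ - g₁ * (f₁ - p * f)) := by noncomm_ring
  have hY'' : InE₀ A (g₁ * (f₁ - p * f) - (f₁ - p * f) * g₁) :=
    (hg₁.mul_inE₂ hψ).sub (hψ.mul_inE₁ hg₁)
  rw [hsplit, hX'.fpTrace_add hY', ← neg_sub (g₁ * (f₁ - p * f)), hY''.fpTrace_neg,
    hg₁.fpTrace_comm_eq_zero hψ, neg_zero, add_zero]

/-- The residue computed with an arbitrary projection `p` onto `A`:
`res_A(f dg) = Tr_V([pf, g])` (Tate 1968, §2, Remark after Thm. 1). [cite: Tate1968, §2, Thm. 1] -/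
theorem res_eq_fpTrace_of_isProj (hp : LinearMap.IsProj A p) (hf : InE A f) (hg : InE A g)
    (hfg : Commute f g) : res A f g = fpTrace (p * f * g - g * (p * f)) :=
  (fpTrace_comm_eq_res hf hg hfg (inE₁_proj_mul hp f) (inE₂_proj_mul_sub hp hf)
    (by rw [sub_self]; exact inE₂_zero)).symm

/-- The defining commutator `[πf, g]` lies in `E₀(A)`. [cite: Tate1968, §2, Thm. 1] -/
theorem inE₀_res_comm (hp : LinearMap.IsProj A p) (hf : InE A f) (hg : InE A g) (hfg : Commute f g) :
    InE₀ A (p * f * g - g * (p * f)) :=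
  inE₀_comm (inE₁_proj_mul hp f) (inE₂_proj_mul_sub hp hf) hg hfg

/-! ### (R1) Bilinearity -/

/-- `res_A((f + f') dg) = res_A(f dg) + res_A(f' dg)`. [cite: Tate1968, §2, (R1)] -/
theorem res_add_left (hf : InE A f) (hf' : InE A f') (hg : InE A g) (hfg : Commute f g)
    (hf'g : Commute f' g) : res A (f + f') g = res A f g + res A f' g := by
  have hp := isProj_proj A
  rw [res, res, res, ← (inE₀_res_comm hp hf hg hfg).fpTrace_add (inE₀_res_comm hp hf' hg hf'g)]
  congr 1; noncomm_ring

/-- `res_A(f d(g + g')) = res_A(f dg) + res_A(f dg')`. [cite: Tate1968, §2, (R1)] -/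
theorem res_add_right (hf : InE A f) (hg : InE A g) (hg' : InE A g') (hfg : Commute f g)
    (hfg' : Commute f g') : res A f (g + g') = res A f g + res A f g' := by
  have hp := isProj_proj A
  rw [res, res, res, ← (inE₀_res_comm hp hf hg hfg).fpTrace_add (inE₀_res_comm hp hf hg' hfg')]
  congr 1; noncomm_ring

/-- `res_A((c f) dg) = c res_A(f dg)`. [cite: Tate1968, §2, (R1)] -/
theorem res_smul_left (c : K) (hf : InE A f) (hg : InE A g) (hfg : Commute f g) :
    res A (c • f) g = c * res A f g := by
  have hp := isProj_proj A
  rw [res, res, ← (inE₀_res_comm hp hf hg hfg).fpTrace_smul c]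
  congr 1
  simp only [mul_smul_comm, smul_mul_assoc, smul_sub]

/-- `res_A(f d(c g)) = c res_A(f dg)`. [cite: Tate1968, §2, (R1)] -/
theorem res_smul_right (c : K) (hf : InE A f) (hg : InE A g) (hfg : Commute f g) :
    res A f (c • g) = c * res A f g := by
  have hp := isProj_proj A
  rw [res, res, ← (inE₀_res_comm hp hf hg hfg).fpTrace_smul c]
  congr 1
  simp only [mul_smul_comm, smul_mul_assoc, smul_sub]

/-- `res_A(0 dg) = 0`. [folklore] -/
@[simp]
theorem res_zero_left (g : Module.End K V) : res A 0 g = 0 := by simp [res]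

/-- `res_A(f d0) = 0`. [folklore] -/
@[simp]
theorem res_zero_right (f : Module.End K V) : res A f 0 = 0 := by simp [res]

/-- `res_A(f d1) = 0`. [cite: Tate1968, §2, (R3)] -/
@[simp]
theorem res_one_right (f : Module.End K V) : res A f 1 = 0 := by simp [res]

/-- `res_A((-f) dg) = -res_A(f dg)`. [cite: Tate1968, §2, (R1)] -/
theorem res_neg_left (hf : InE A f) (hg : InE A g) (hfg : Commute f g) : res A (-f) g = -res A f g := by
  simpa using res_smul_left (-1) hf hg hfg

/-- `res_A(f d(-g)) = -res_A(f dg)`. [cite: Tate1968, §2, (R1)] -/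
theorem res_neg_right (hf : InE A f) (hg : InE A g) (hfg : Commute f g) : res A f (-g) = -res A f g := by
  simpa using res_smul_right (-1) hf hg hfg

/-- `res_A((f - f') dg) = res_A(f dg) - res_A(f' dg)`. [cite: Tate1968, §2, (R1)] -/
theorem res_sub_left (hf : InE A f) (hf' : InE A f') (hg : InE A g) (hfg : Commute f g)
    (hf'g : Commute f' g) : res A (f - f') g = res A f g - res A f' g := by
  rw [sub_eq_add_neg, res_add_left hf hf'.neg hg hfg hf'g.neg_left, res_neg_left hf' hg hf'g,
    sub_eq_add_neg]

/-- `res_A(f d(g - g')) = res_A(f dg) - res_A(f dg')`. [cite: Tate1968, §2, (R1)] -/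
theorem res_sub_right (hf : InE A f) (hg : InE A g) (hg' : InE A g') (hfg : Commute f g)
    (hfg' : Commute f g') : res A f (g - g') = res A f g - res A f g' := by
  rw [sub_eq_add_neg, res_add_right hf hg hg'.neg hfg hfg'.neg_right, res_neg_right hf hg' hfg',
    sub_eq_add_neg]

/-! ### (R2) Continuity: vanishing -/

/-- For a projection `p` onto `B` and commuting `f, g` with `fB + fgB ⊆ B`, the commutator
`[pf, g]` kills `B`. [cite: Tate1968, §2, (R2)] -/
theorem comm_proj_apply_eq_zero {B : Submodule K V} (hp : LinearMap.IsProj B p) (hfg : Commute f g)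
    (h₁ : B.map f ≤ B) (h₂ : B.map (f * g) ≤ B) : ∀ b ∈ B, (p * f * g - g * (p * f)) b = 0 := by
  intro b hb
  have hfb : f b ∈ B := h₁ (Submodule.mem_map_of_mem hb)
  have hfgb : f (g b) ∈ B := h₂ (Submodule.mem_map_of_mem hb)
  change p (f (g b)) - g (p (f b)) = 0
  rw [hp.map_id _ hfgb, hp.map_id _ hfb]
  change (f * g) b - (g * f) b = 0
  rw [hfg.eq, sub_self]

/-- For a projection `p` onto `B` and commuting `f, g` with `fgB + fg²B ⊆ B`, the commutator
`[pf, g]` kills `gB`. [cite: Tate1968, §2, (R2)] -/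
theorem comm_proj_apply_eq_zero' {B : Submodule K V} (hp : LinearMap.IsProj B p) (hfg : Commute f g)
    (h₂ : B.map (f * g) ≤ B) (h₃ : B.map (f * g * g) ≤ B) :
    ∀ b ∈ B, (p * f * g - g * (p * f)) (g b) = 0 := by
  intro b hb
  have hfgb : f (g b) ∈ B := h₂ (Submodule.mem_map_of_mem hb)
  have hfggb : f (g (g b)) ∈ B := h₃ (Submodule.mem_map_of_mem hb)
  change p (f (g (g b))) - g (p (f (g b))) = 0
  rw [hp.map_id _ hfggb, hp.map_id _ hfgb]
  change (f * g * g) b - (g * (f * g)) b = 0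
  rw [← mul_assoc, ← hfg.eq, sub_self]

/-- For a projection `p` onto `B` and commuting `f, g` with `fB + fgB + fg²B ⊆ B`, the commutator
`[pf, g]` maps `V` into `B + gB` and kills `B + gB`, so it has square zero. [cite: Tate1968, §2, (R2)] -/
theorem comm_proj_mul_self {B : Submodule K V} (hp : LinearMap.IsProj B p) (hfg : Commute f g)
    (h₁ : B.map f ≤ B) (h₂ : B.map (f * g) ≤ B) (h₃ : B.map (f * g * g) ≤ B) :
    (p * f * g - g * (p * f)) * (p * f * g - g * (p * f)) = 0 := by
  ext v
  have hv : (p * f * g - g * (p * f)) v = p (f (g v)) - g (p (f v)) := rfl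
  rw [Module.End.mul_apply, hv, map_sub, comm_proj_apply_eq_zero hp hfg h₁ h₂ _ (hp.map_mem _),
    comm_proj_apply_eq_zero' hp hfg h₂ h₃ _ (hp.map_mem _), sub_self, LinearMap.zero_apply]

/-- **(R2)**: if `fA + fgA + fg²A ⊆ A` then `res_A(f dg) = 0` — the commutator `[πf, g]` has
square zero (Tate 1968, §2, (R2)). [cite: Tate1968, §2, (R2)] -/
theorem res_eq_zero_of_map_le (hfg : Commute f g) (h₁ : A.map f ≤ A) (h₂ : A.map (f * g) ≤ A)
    (h₃ : A.map (f * g * g) ≤ A) : res A f g = 0 :=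
  fpTrace_eq_zero_of_isNilpotent ⟨2, by rw [pow_two, comm_proj_mul_self (isProj_proj A) hfg h₁ h₂ h₃]⟩

/-- **(R2)**, special case: `res_A(f dg) = 0` if `fA ⊆ A` and `gA ⊆ A` (Tate 1968, §2, (R2)).
[cite: Tate1968, §2, (R2)] -/
theorem res_eq_zero_of_invariant (hfg : Commute f g) (hfA : A.map f ≤ A) (hgA : A.map g ≤ A) :
    res A f g = 0 := by
  refine res_eq_zero_of_map_le hfg hfA ?_ ?_
  · rw [Module.End.mul_eq_comp, Submodule.map_comp]; exact (Submodule.map_mono hgA).trans hfA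
  · rw [Module.End.mul_eq_comp, Module.End.mul_eq_comp, Submodule.map_comp, Submodule.map_comp]
    exact (Submodule.map_mono ((Submodule.map_mono hgA).trans hgA)).trans hfA

/-! ### (R3) `res(gⁿ dg) = 0` -/

/-- `(πg)ⁿ ≡ gⁿ (mod E₂)`. [cite: Tate1968, §2, (R3)] -/
theorem inE₂_proj_mul_pow_sub (hp : LinearMap.IsProj A p) (hg : InE A g) (n : ℕ) :
    InE₂ A ((p * g) ^ n - g ^ n) := by
  induction n with
  | zero => simp only [pow_zero, sub_self]; exact inE₂_zero
  | succ n ih =>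
    have : (p * g) ^ (n + 1) - g ^ (n + 1) = ((p * g) ^ n - g ^ n) * (p * g) + g ^ n * (p * g - g) := by
      rw [pow_succ, pow_succ]; noncomm_ring
    rw [this]
    exact (ih.mul_right ((inE_proj hp).mul hg)).add ((inE₂_proj_mul_sub hp hg).mul_left _)

/-- **(R3)**: `res_A(gⁿ dg) = 0` for `n ≥ 0` (Tate 1968, §2, (R3): with `g₁ = πg ∈ E₁`,
`res(gⁿ dg) = Tr [g₁ⁿ, g₁] = 0`). [cite: Tate1968, §2, (R3)] -/
theorem res_pow_self (hg : InE A g) (n : ℕ) : res A (g ^ n) g = 0 := by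
  have hp := isProj_proj A
  rw [← fpTrace_comm_eq_res' (hg.pow n) hg (Commute.pow_left (Commute.refl g) n) (inE₁_proj_mul hp g)
    (inE₂_proj_mul_pow_sub hp hg n) (inE₂_proj_mul_sub hp hg), (Commute.pow_left (Commute.refl _) n).eq,
    sub_self, fpTrace_zero]

/-- `res_A(g dg) = 0`. [cite: Tate1968, §2, (R3)] -/
theorem res_self (hg : InE A g) : res A g g = 0 := by simpa using res_pow_self hg 1

/-- `res_A(dg) = res_A(1 dg) = 0`. [cite: Tate1968, §2, (R3)] -/
theorem res_one_left (hg : InE A g) : res A 1 g = 0 := by simpa using res_pow_self hg 0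

/-! ### The derivation rule `res(f d(gh)) = res(fg dh) + res(fh dg)` -/

/-- **Leibniz rule** for Tate's residue: `res_A(f d(gh)) = res_A(fg dh) + res_A(fh dg)` for pairwise
commuting `f, g, h ∈ E(A)` (Tate 1968, §2, proof of Thm. 1: the residue factors through Kähler
differentials, via the identity `[f₁, g₁h₁] - [f₁g₁, h₁] - [f₁h₁, g₁] = [g₁, [f₁, h₁]]`).
[cite: Tate1968, §2, Thm. 1] -/
theorem res_mul_right (hf : InE A f) (hg : InE A g) (hh : InE A h) (hfg : Commute f g)
    (hfh : Commute f h) (hgh : Commute g h) :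
    res A f (g * h) = res A (f * g) h + res A (f * h) g := by
  set p := proj A
  have hp := isProj_proj A
  -- admissible lifts
  have hf₁ := inE₁_proj_mul hp f
  have hf₁' := inE₂_proj_mul_sub hp hf
  have hg₁' := inE₂_proj_mul_sub hp hg
  have hh₁' := inE₂_proj_mul_sub hp hh
  have hgE := (inE_proj hp).mul hg
  have hhE := (inE_proj hp).mul hh
  have hgh₁ : InE₂ A (p * g * (p * h) - g * h) := by
    have : p * g * (p * h) - g * h = (p * g - g) * (p * h) + g * (p * h - h) := by noncomm_ring
    rw [this]; exact (hg₁'.mul_right hhE).add (hh₁'.mul_left g)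
  have hfg₁ : InE₁ A (p * f * (p * g)) := hf₁.mul_right _
  have hfg₁' : InE₂ A (p * f * (p * g) - f * g) := by
    have : p * f * (p * g) - f * g = (p * f - f) * (p * g) + f * (p * g - g) := by noncomm_ring
    rw [this]; exact (hf₁'.mul_right hgE).add (hg₁'.mul_left f)
  have hfh₁ : InE₁ A (p * f * (p * h)) := hf₁.mul_right _
  have hfh₁' : InE₂ A (p * f * (p * h) - f * h) := by
    have : p * f * (p * h) - f * h = (p * f - f) * (p * h) + f * (p * h - h) := by noncomm_ring
    rw [this]; exact (hf₁'.mul_right hhE).add (hh₁'.mul_left f)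
  rw [← fpTrace_comm_eq_res hf (hg.mul hh) (hfg.mul_right hfh) hf₁ hf₁' hgh₁,
    ← fpTrace_comm_eq_res (hf.mul hg) hh (hfh.mul_left hgh) hfg₁ hfg₁' hh₁',
    ← fpTrace_comm_eq_res (hf.mul hh) hg (hfg.mul_left hgh.symm) hfh₁ hfh₁' hg₁']
  -- the three commutators and the double commutator are in `E₀`
  have hC₁ : InE₀ A (p * f * (p * g * (p * h)) - p * g * (p * h) * (p * f)) :=
    inE₀_comm' hf₁ hf₁' (hg.mul hh) (hfg.mul_right hfh) hgh₁
  have hC₂ : InE₀ A (p * f * (p * g) * (p * h) - p * h * (p * f * (p * g))) :=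
    inE₀_comm' hfg₁ hfg₁' hh (hfh.mul_left hgh) hh₁'
  have hC₃ : InE₀ A (p * f * (p * h) * (p * g) - p * g * (p * f * (p * h))) :=
    inE₀_comm' hfh₁ hfh₁' hg (hfg.mul_left hgh.symm) hg₁'
  have hφ : InE₀ A (p * f * (p * h) - p * h * (p * f)) := inE₀_comm' hf₁ hf₁' hh hfh hh₁'
  have hT : InE₀ A (p * g * (p * f * (p * h) - p * h * (p * f)) - (p * f * (p * h) - p * h * (p * f)) * (p * g)) :=
    (hφ.mul_left hgE).sub (hφ.mul_right hgE)
  have hsplit : p * f * (p * g * (p * h)) - p * g * (p * h) * (p * f) =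
      (p * f * (p * g) * (p * h) - p * h * (p * f * (p * g))) +
      (p * f * (p * h) * (p * g) - p * g * (p * f * (p * h))) +
      (p * g * (p * f * (p * h) - p * h * (p * f)) - (p * f * (p * h) - p * h * (p * f)) * (p * g)) := by
    noncomm_ring
  rw [hsplit, (hC₂.add hC₃).fpTrace_add hT, hC₂.fpTrace_add hC₃, hφ.fpTrace_comm_eq_zero' hgE, add_zero]

/-- **(R3)** for negative exponents: if `g g' = g' g = 1` (so `g' = g⁻¹`) with `g, g' ∈ E(A)`, then
`res_A(g'ⁿ dg) = 0` for `n ≥ 2` (Tate 1968, §2, (R3): `g⁻ⁿ dg = -(g⁻¹)ⁿ⁻² d(g⁻¹)`).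
[cite: Tate1968, §2, (R3)] -/
theorem res_inv_pow (hg : InE A g) (hg' : InE A g') (hgg' : g * g' = 1) (hg'g : g' * g = 1) (n : ℕ)
    (hn : 2 ≤ n) : res A (g' ^ n) g = 0 := by
  obtain ⟨m, rfl⟩ := Nat.exists_eq_add_of_le hn
  have hcomm : Commute g g' := by rw [Commute, SemiconjBy, hgg', hg'g]
  -- Leibniz: 0 = res(g'^(m+1) d(g g')) = res(g'^(m+1) g dg') + res(g'^(m+1) g' dg)
  have h := res_mul_right (hg'.pow (m + 1)) hg hg' ((hcomm.symm.pow_left (m + 1)))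
    ((Commute.refl g').pow_left (m + 1)) hcomm
  rw [hgg', res_one_right] at h
  have e₁ : g' ^ (m + 1) * g = g' ^ m := by rw [pow_succ, mul_assoc, hg'g, mul_one]
  have e₂ : g' ^ (m + 1) * g' = g' ^ (2 + m) := by rw [← pow_succ, show m + 1 + 1 = 2 + m by omega]
  rw [e₁, e₂, res_pow_self hg'] at h
  linear_combination -h

/-! ### (R4) `res(g⁻¹ dg) = dim A/gA` -/

/-- Two complements of the same subspace `B` inside `A` have the same dimension. [folklore] -/
theorem finrank_eq_of_compl_eq {B C C' : Submodule K V} [FiniteDimensional K C] (hCA : C ≤ A)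
    (hC : Disjoint C B) (hC₂ : C ⊔ B = A) (hC'A : C' ≤ A) (hC' : Disjoint C' B) (hC'₂ : C' ⊔ B = A) :
    FiniteDimensional K C' ∧ finrank K C' = finrank K C := by
  have hBA : B ≤ A := le_sup_right.trans hC₂.le
  -- work inside `A`
  let B' := B.comap A.subtype
  have key : ∀ D : Submodule K V, D ≤ A → Disjoint D B → D ⊔ B = A →
      Nonempty ((↥A ⧸ B') ≃ₗ[K] D) := fun D hDA hD hD₂ ↦ by
    let D' := D.comap A.subtype
    have hc : IsCompl B' D' := by
      refine ⟨?_, ?_⟩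
      · rw [disjoint_comm, Submodule.disjoint_def] at hD ⊢
        intro x hx₁ hx₂
        exact Subtype.ext (hD _ hx₂ hx₁)
      · rw [codisjoint_iff, eq_top_iff]
        rintro ⟨x, hx⟩ -
        rw [← hD₂] at hx
        obtain ⟨d, hd, b, hb, rfl⟩ := Submodule.mem_sup.1 hx
        exact Submodule.mem_sup.2 ⟨⟨b, hBA hb⟩, hb, ⟨d, hDA hd⟩, hd, by ext; simp [add_comm]⟩
    exact ⟨(Submodule.quotientEquivOfIsCompl B' D' hc).trans (Submodule.comapSubtypeEquivOfLe hDA)⟩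
  obtain ⟨e⟩ := key C hCA hC hC₂
  obtain ⟨e'⟩ := key C' hC'A hC' hC'₂
  haveI : FiniteDimensional K (↥A ⧸ B') := LinearEquiv.finiteDimensional e.symm
  exact ⟨LinearEquiv.finiteDimensional e', by rw [← e'.finrank_eq, e.finrank_eq]⟩

/-- **(R4)**: if `g'g = 1`, `gA ⊆ A` and `C` is a finite-dimensional complement of `gA` in `A`, then
`res_A(g' dg) = dim_K C (= dim_K A/gA)` (Tate 1968, §2, (R4) with `h = 1`: `[πg⁻¹, g] = π - gπg⁻¹`,
whose trace is that of the identity of a complement of `gA` in `A`). [cite: Tate1968, §2, (R4)] -/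
theorem res_inv_eq_finrank (hg'g : g' * g = 1) (hgA : A.map g ≤ A) {C : Submodule K V} [FiniteDimensional K C] (hCA : C ≤ A)
    (hC : Disjoint C (A.map g)) (hC₂ : C ⊔ A.map g = A) : res A g' g = (finrank K C : K) := by
  set p := proj A
  have hp := isProj_proj A
  have hpp : p * p = p := LinearMap.ext fun x ↦ hp.map_id _ (hp.map_mem x)
  -- θ = [p g', g] = p - ρ with ρ = g p g' an idempotent with image gA fixing gA
  set ρ := g * p * g' with hρ
  have hθ : p * g' * g - g * (p * g') = p - ρ := by
    rw [mul_assoc, hg'g, mul_one, hρ, mul_assoc]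
  have hρA : ∀ x, ρ x ∈ A.map g := fun x ↦ ⟨p (g' x), hp.map_mem _, rfl⟩
  have hρid : ∀ x ∈ A.map g, ρ x = x := by
    rintro _ ⟨a, ha, rfl⟩
    simp only [hρ, Module.End.mul_apply]
    rw [← Module.End.mul_apply g' g, hg'g, Module.End.one_apply, hp.map_id a ha]
  have hρρ : ∀ x, ρ (ρ x) = ρ x := fun x ↦ hρid _ (hρA x)
  -- the complement C' = A ∩ ker ρ
  set C' : Submodule K V := A ⊓ LinearMap.ker ρ with hC'
  have hC'A : C' ≤ A := inf_le_left
  have hC'd : Disjoint C' (A.map g) := by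
    rw [Submodule.disjoint_def]
    intro x hx hx'
    rw [← hρid x hx']; exact hx.2
  have hC'₂ : C' ⊔ A.map g = A := by
    refine le_antisymm (sup_le hC'A hgA) fun a ha ↦ ?_
    rw [show a = (a - ρ a) + ρ a by abel]
    refine Submodule.add_mem_sup ⟨Submodule.sub_mem _ ha (hgA (hρA a)), ?_⟩ (hρA a)
    simp only [SetLike.mem_coe, LinearMap.mem_ker, map_sub, hρρ, sub_self]
  obtain ⟨hfin, hrank⟩ := finrank_eq_of_compl_eq (B := A.map g) hCA hC hC₂ hC'A hC'd hC'₂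
  haveI := hfin
  -- θ maps V into A, A into C', and is the identity on C'
  have hθC' : ∀ x ∈ C', (p - ρ) x ∈ C' := fun x hx ↦ by
    rw [LinearMap.sub_apply, hp.map_id x hx.1, (LinearMap.mem_ker.1 hx.2), sub_zero]; exact hx
  have hθ2 : range ((p - ρ) ^ 2) ≤ C' := by
    rintro _ ⟨v, rfl⟩
    rw [pow_two, Module.End.mul_apply, LinearMap.sub_apply p ρ ((p - ρ) v), hp.map_id _ ?_]
    · refine ⟨Submodule.sub_mem _ ?_ (hgA (hρA _)), ?_⟩
      · exact Submodule.sub_mem _ (hp.map_mem v) (hgA (hρA v))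
      · simp only [SetLike.mem_coe, LinearMap.mem_ker, map_sub, hρρ, sub_self]
    · exact Submodule.sub_mem _ (hp.map_mem v) (hgA (hρA v))
  rw [res, hθ, fpTrace_eq_trace_restrict hθC' hθ2, ← hrank, ← LinearMap.trace_id]
  congr 1
  ext ⟨x, hx⟩
  simp only [coe_restrict_apply, LinearMap.sub_apply, LinearMap.id_coe, id_eq]
  rw [hp.map_id x hx.1, LinearMap.mem_ker.1 hx.2, sub_zero]

/-! ### Functoriality: invariant subspaces, isomorphisms and direct sums -/

section compComm

variable {V' : Type*} [AddCommGroup V'] [Module K V']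

/-- `(φψ)ᵐ φ = φ (ψφ)ᵐ` for `φ : V' → V`, `ψ : V → V'`. [folklore] -/
theorem pow_comp_eq_comp_pow (φ : V' →ₗ[K] V) (ψ : V →ₗ[K] V') (m : ℕ) :
    ((φ ∘ₗ ψ) ^ m) ∘ₗ φ = φ ∘ₗ ((ψ ∘ₗ φ) ^ m) := by
  induction m with
  | zero => simp [Module.End.one_eq_id]
  | succ m ih =>
    rw [pow_succ, Module.End.mul_eq_comp, LinearMap.comp_assoc, LinearMap.comp_assoc,
      ← LinearMap.comp_assoc (ψ ∘ₗ φ) φ, ih, LinearMap.comp_assoc, ← Module.End.mul_eq_comp, ← pow_succ]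

/-- If `ψφ` is finite-potent then so is `φψ`. [cite: Tate1968, §1 (T5)] -/
theorem IsFinitePotent.of_comp_comm {φ : V' →ₗ[K] V} {ψ : V →ₗ[K] V'} (h : IsFinitePotent (ψ ∘ₗ φ)) :
    IsFinitePotent (φ ∘ₗ ψ) := by
  obtain ⟨n, hn⟩ := h
  refine ⟨n + 1, ?_⟩
  have : (φ ∘ₗ ψ) ^ (n + 1) = (φ ∘ₗ (ψ ∘ₗ φ) ^ n) ∘ₗ ψ := by
    rw [pow_succ, Module.End.mul_eq_comp, ← LinearMap.comp_assoc, pow_comp_eq_comp_pow]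
  rw [this]
  exact Submodule.finiteDimensional_of_le
    ((range_comp_le_range ψ _).trans (by rw [range_comp]))

/-- **(T5)**, two-space form: for `φ : V' → V`, `ψ : V → V'` with `ψφ` finite-potent,
`Tr_V(φψ) = Tr_{V'}(ψφ)` (Tate 1968, §1 (T5): `φ` and `ψ` induce maps between `(ψφ)ᵐV'` and
`(φψ)ᵐV` whose composites are the two restrictions). [cite: Tate1968, §1 (T5)] -/
theorem fpTrace_comp_comm (φ : V' →ₗ[K] V) (ψ : V →ₗ[K] V') (h : IsFinitePotent (ψ ∘ₗ φ)) :
    fpTrace (φ ∘ₗ ψ) = fpTrace (ψ ∘ₗ φ) := by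
  obtain ⟨m, hm⟩ := h.of_comp_comm
  obtain ⟨n, hn⟩ := h
  haveI h₁ : FiniteDimensional K (range ((ψ ∘ₗ φ) ^ (n + m))) :=
    Submodule.finiteDimensional_of_le (range_pow_add_le _ n m)
  haveI h₂ : FiniteDimensional K (range ((φ ∘ₗ ψ) ^ (n + m))) :=
    Submodule.finiteDimensional_of_le (range_pow_add_le' _ n m)
  set W₁ := range ((ψ ∘ₗ φ) ^ (n + m))
  set W₂ := range ((φ ∘ₗ ψ) ^ (n + m))
  have ha : ∀ x ∈ W₁, φ x ∈ W₂ := by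
    rintro _ ⟨y, rfl⟩
    refine ⟨φ y, ?_⟩
    have := congrArg (fun T : V' →ₗ[K] V ↦ T y) (pow_comp_eq_comp_pow φ ψ (n + m))
    simpa using this
  have hb : ∀ x ∈ W₂, ψ x ∈ W₁ := by
    rintro _ ⟨y, rfl⟩
    refine ⟨ψ y, ?_⟩
    have := congrArg (fun T : V →ₗ[K] V' ↦ T y) (pow_comp_eq_comp_pow ψ φ (n + m))
    simpa using this
  rw [fpTrace_eq_trace_restrict (mapsTo_range_pow (ψ ∘ₗ φ) (n + m)) le_rfl,
    fpTrace_eq_trace_restrict (mapsTo_range_pow (φ ∘ₗ ψ) (n + m)) le_rfl]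
  have e₁ : (ψ ∘ₗ φ).restrict (mapsTo_range_pow (ψ ∘ₗ φ) (n + m)) = ψ.restrict hb ∘ₗ φ.restrict ha := rfl
  have e₂ : (φ ∘ₗ ψ).restrict (mapsTo_range_pow (φ ∘ₗ ψ) (n + m)) = φ.restrict ha ∘ₗ ψ.restrict hb := rfl
  rw [e₁, e₂, trace_comp_comm']

end compComm

section restrict

variable {V₀ : Submodule K V}

/-- `E(A)` passes to an invariant subspace `V₀ ⊇ A` (modular law:
`(A + W) ∩ V₀ = A + (W ∩ V₀)`). [folklore] -/
theorem InE.restrict (hA : A ≤ V₀) (hf : InE A f) (hfV : ∀ x ∈ V₀, f x ∈ V₀) :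
    InE (A.comap V₀.subtype) (f.restrict hfV) := by
  obtain ⟨W, _, hW⟩ := hf
  haveI : FiniteDimensional K ((W ⊓ V₀).comap V₀.subtype) :=
    LinearEquiv.finiteDimensional (Submodule.comapSubtypeEquivOfLe (inf_le_right : W ⊓ V₀ ≤ V₀)).symm
  refine ⟨(W ⊓ V₀).comap V₀.subtype, inferInstance, ?_⟩
  rintro _ ⟨⟨a, haV⟩, ha, rfl⟩
  have hfa : f a ∈ A ⊔ W := hW (Submodule.mem_map_of_mem ha)
  obtain ⟨a', ha', w, hw, hsum⟩ := Submodule.mem_sup.1 hfa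
  have hwV : w ∈ V₀ := by
    have : w = f a - a' := by rw [← hsum]; abel
    rw [this]; exact Submodule.sub_mem _ (hfV a haV) (hA ha')
  refine Submodule.mem_sup.2 ⟨⟨a', hA ha'⟩, ha', ⟨w, hwV⟩, ⟨hw, hwV⟩, ?_⟩
  ext; exact hsum

/-- **(R1)**: the residue may be computed in any `f, g`-invariant subspace `V₀ ⊇ A`:
`res^V_A(f dg) = res^{V₀}_A(f dg)` (Tate 1968, §2, (R1): "if `V ⊇ V' ⊇ A` and `KV' = V'` then
`res^V_A = res^{V'}_A`"). Proof: extend a projection `p'` of `V₀` onto `A` to `P = ι p' π` with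
`π` a projection of `V` onto `V₀`; then `[Pf, g] = ι[p'f', g']π + Z` with `Z` of square zero, and
`Tr_V(ι T π) = Tr_{V₀}(T)` by (T5). [cite: Tate1968, §2, (R1)] -/
theorem res_eq_res_restrict (hA : A ≤ V₀) (hfV : ∀ x ∈ V₀, f x ∈ V₀) (hgV : ∀ x ∈ V₀, g x ∈ V₀)
    (hf : InE A f) (hg : InE A g) (hfg : Commute f g) :
    res A f g = res (A.comap V₀.subtype) (f.restrict hfV) (g.restrict hgV) := by
  set A' := A.comap V₀.subtype
  set f' := f.restrict hfV
  set g' := g.restrict hgV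
  have hf' : InE A' f' := hf.restrict hA hfV
  have hg' : InE A' g' := hg.restrict hA hgV
  have hfg' : Commute f' g' := LinearMap.restrict_commute hfg _ _
  obtain ⟨C, hC⟩ := V₀.exists_isCompl
  set ι : V₀ →ₗ[K] V := V₀.subtype
  set π : V →ₗ[K] V₀ := V₀.projectionOnto C hC
  have hπι : π ∘ₗ ι = LinearMap.id := LinearMap.ext fun x ↦ Submodule.projectionOnto_apply_left hC x
  set p' := proj A'
  have hp' := isProj_proj A'
  set P : Module.End K V := ι ∘ₗ p' ∘ₗ π with hP
  have hπι' : ∀ w : V₀, π (w : V) = w := fun w ↦ Submodule.projectionOnto_apply_left hC w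
  have hPproj : LinearMap.IsProj A P := by
    constructor
    · intro x; exact hp'.map_mem (π x)
    · intro a ha
      have h1 : π a = ⟨a, hA ha⟩ := hπι' ⟨a, hA ha⟩
      have h2 : p' ⟨a, hA ha⟩ = ⟨a, hA ha⟩ := hp'.map_id _ ha
      change ι (p' (π a)) = a
      rw [h1, h2]; rfl
  -- the defining commutators in `V₀` and in `V`
  set T : Module.End K V₀ := p' * f' * g' - g' * (p' * f') with hT
  set X : Module.End K V := P * f * g - g * (P * f) with hX
  set Y : Module.End K V := (ι ∘ₗ T) ∘ₗ π with hY
  have hTE : InE₀ A' T := inE₀_res_comm hp' hf' hg' hfg'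
  have hXE : InE₀ A X := inE₀_res_comm hPproj hf hg hfg
  -- X and Y agree on V₀ and take values in V₀
  have hXι : ∀ w : V₀, X w = T w := fun w ↦ by
    change ι (p' (π (f (g (w : V))))) - g (ι (p' (π (f (w : V))))) = _
    have e1 : g (w : V) = ((g' w : V₀) : V) := rfl
    have e2 : ∀ u : V₀, f (u : V) = ((f' u : V₀) : V) := fun u ↦ rfl
    have e3 : ∀ u : V₀, g (ι u) = ((g' u : V₀) : V) := fun u ↦ rfl
    rw [e1, e2, hπι', e2, hπι', e3]
    rfl
  have hYι : ∀ w : V₀, Y w = T w := fun w ↦ by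
    change ι (T (π (w : V))) = _
    rw [hπι']; rfl
  have hXV : ∀ v, X v ∈ V₀ := fun v ↦
    Submodule.sub_mem _ (Submodule.coe_mem _) (hgV _ (Submodule.coe_mem _))
  have hYV : ∀ v, Y v ∈ V₀ := fun v ↦ (T (π v)).2
  -- Z := X - Y has square zero
  have hZ2 : (X - Y) * (X - Y) = 0 := by
    ext v
    have hmem : (X - Y) v ∈ V₀ := Submodule.sub_mem _ (hXV v) (hYV v)
    rw [Module.End.mul_apply, LinearMap.zero_apply]
    have := congrArg₂ (· - ·) (hXι ⟨_, hmem⟩) (hYι ⟨_, hmem⟩)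
    simpa using this
  -- Y ∈ E₀(A)
  have hYE : InE₀ A Y := by
    constructor
    · have h1 : range Y ≤ (range T).map ι := by
        rintro _ ⟨v, rfl⟩; exact ⟨T (π v), LinearMap.mem_range_self _ _, rfl⟩
      have h2 : NearlyLE ((range T).map ι) (A'.map ι) := hTE.1.map' ι
      refine (h2.mono_left h1).mono_right ?_
      rintro _ ⟨a, ha, rfl⟩; exact ha
    · haveI := hTE.2.finiteDimensional
      have : A.map Y ≤ (A'.map T).map ι := by
        rintro _ ⟨a, ha, rfl⟩
        refine ⟨T ⟨a, hA ha⟩, ⟨⟨a, hA ha⟩, ha, rfl⟩, ?_⟩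
        change ι (T ⟨a, hA ha⟩) = ι (T (π a))
        rw [show π a = ⟨a, hA ha⟩ from hπι' ⟨a, hA ha⟩]
      exact Submodule.finiteDimensional_of_le this
  have hZE : InE₀ A (X - Y) := hXE.sub hYE
  -- conclusion
  have hZtr : fpTrace (X - Y) = 0 := fpTrace_eq_zero_of_isNilpotent ⟨2, by rw [pow_two, hZ2]⟩
  have hYtr : fpTrace Y = fpTrace T := by
    rw [hY, fpTrace_comp_comm (ι ∘ₗ T) π, ← LinearMap.comp_assoc, hπι, LinearMap.id_comp]
    rw [← LinearMap.comp_assoc, hπι, LinearMap.id_comp]; exact hTE.isFinitePotent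
  rw [res_eq_fpTrace_of_isProj hPproj hf hg hfg, ← hX, show X = Y + (X - Y) by abel, hYE.fpTrace_add hZE,
    hZtr, add_zero, hYtr]
  rfl

end restrict

section conj

variable {V' : Type*} [AddCommGroup V'] [Module K V']

/-- `(e X e⁻¹)(e B) = e (X B)`. [folklore] -/
theorem map_map_conj (e : V ≃ₗ[K] V') (X : Module.End K V) (B : Submodule K V) :
    (B.map (e : V →ₗ[K] V')).map (e.conj X) = (B.map X).map (e : V →ₗ[K] V') := by
  rw [LinearEquiv.conj_apply, Submodule.map_comp, Submodule.map_comp,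
    Submodule.map_equiv_eq_comap_symm e B, Submodule.map_comap_eq_of_surjective e.symm.surjective]

/-- `≼` is invariant under isomorphisms. [folklore] -/
theorem NearlyLE.map_equiv (e : V ≃ₗ[K] V') {B B' : Submodule K V} (h : NearlyLE B B') :
    NearlyLE (B.map (e : V →ₗ[K] V')) (B'.map (e : V →ₗ[K] V')) := by
  obtain ⟨W, _, h⟩ := h
  exact ⟨W.map (e : V →ₗ[K] V'), inferInstance, (Submodule.map_mono h).trans (by rw [Submodule.map_sup])⟩

/-- `E(A)` is transported by isomorphisms. [folklore] -/
theorem InE.conj (e : V ≃ₗ[K] V') (hf : InE A f) : InE (A.map (e : V →ₗ[K] V')) (e.conj f) := by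
  rw [InE, map_map_conj]; exact hf.map_equiv e

/-- `E₁(A)` is transported by isomorphisms. [folklore] -/
theorem InE₁.conj (e : V ≃ₗ[K] V') (hf : InE₁ A f) : InE₁ (A.map (e : V →ₗ[K] V')) (e.conj f) := by
  rw [InE₁, range_conj]; exact hf.map_equiv e

/-- `E₂(A)` is transported by isomorphisms. [folklore] -/
theorem InE₂.conj (e : V ≃ₗ[K] V') (hf : InE₂ A f) : InE₂ (A.map (e : V →ₗ[K] V')) (e.conj f) := by
  haveI := hf.finiteDimensional
  rw [InE₂, map_map_conj]; infer_instance

/-- **(R1), invariance**: the residue is invariant under isomorphisms `e : V ≃ V'` carrying `A, f, g`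
to `eA, efe⁻¹, ege⁻¹` (Tate 1968, §2, (R1)). [cite: Tate1968, §2, (R1)] -/
theorem res_conj (e : V ≃ₗ[K] V') (hf : InE A f) (hg : InE A g) (hfg : Commute f g) :
    res (A.map (e : V →ₗ[K] V')) (e.conj f) (e.conj g) = res A f g := by
  have hp := isProj_proj A
  have hfg' : Commute (e.conj f) (e.conj g) := by
    rw [Commute, SemiconjBy, Module.End.mul_eq_comp, Module.End.mul_eq_comp, ← LinearEquiv.conj_comp,
      ← LinearEquiv.conj_comp, ← Module.End.mul_eq_comp, ← Module.End.mul_eq_comp, hfg.eq]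
  have h₁ : InE₁ (A.map (e : V →ₗ[K] V')) (e.conj (proj A * f)) := (inE₁_proj_mul hp f).conj e
  have h₂ : InE₂ (A.map (e : V →ₗ[K] V')) (e.conj (proj A * f) - e.conj f) := by
    rw [← map_sub]; exact (inE₂_proj_mul_sub hp hf).conj e
  rw [← fpTrace_comm_eq_res (hf.conj e) (hg.conj e) hfg' h₁ h₂ (by rw [sub_self]; exact inE₂_zero),
    res, ← fpTrace_conj e]
  congr 1
  simp only [map_sub, Module.End.mul_eq_comp, LinearEquiv.conj_comp]

end conj

section isCompl

variable {V₁ V₂ A₁ A₂ : Submodule K V}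

/-- **(R1) / (R5), direct sums**: if `V = V₁ ⊕ V₂` with `f, g` preserving both summands and
`A = A₁ ⊕ A₂` with `Aᵢ ⊆ Vᵢ`, then `res_A(f dg) = res_{A₁}(f dg)|_{V₁} + res_{A₂}(f dg)|_{V₂}`
(Tate 1968, §3, proof of Thm. 3: "`V_S = V_T × ∏ K_p` and `A_S = A_T × ∏ A_p`").
[cite: Tate1968, §3, Thm. 3] -/
theorem res_eq_add_of_isCompl (hc : IsCompl V₁ V₂) (hA₁ : A₁ ≤ V₁) (hA₂ : A₂ ≤ V₂)
    (hf₁ : ∀ x ∈ V₁, f x ∈ V₁) (hf₂ : ∀ x ∈ V₂, f x ∈ V₂) (hg₁ : ∀ x ∈ V₁, g x ∈ V₁)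
    (hg₂ : ∀ x ∈ V₂, g x ∈ V₂) (hf : InE (A₁ ⊔ A₂) f) (hg : InE (A₁ ⊔ A₂) g) (hfg : Commute f g)
    (hf₁' : InE (A₁.comap V₁.subtype) (f.restrict hf₁)) (hg₁' : InE (A₁.comap V₁.subtype) (g.restrict hg₁))
    (hf₂' : InE (A₂.comap V₂.subtype) (f.restrict hf₂)) (hg₂' : InE (A₂.comap V₂.subtype) (g.restrict hg₂)) :
    res (A₁ ⊔ A₂) f g =
      res (A₁.comap V₁.subtype) (f.restrict hf₁) (g.restrict hg₁) +
        res (A₂.comap V₂.subtype) (f.restrict hf₂) (g.restrict hg₂) := by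
  set e := Submodule.prodEquivOfIsCompl V₁ V₂ hc
  set B₁ := A₁.comap V₁.subtype
  set B₂ := A₂.comap V₂.subtype
  have hp₁ := isProj_proj B₁
  have hp₂ := isProj_proj B₂
  -- the glued projection onto A₁ ⊔ A₂
  set P : Module.End K V := e.conj ((proj B₁).prodMap (proj B₂)) with hP
  have hPapply : ∀ (x₁ : V₁) (x₂ : V₂), P (x₁ + x₂) = proj B₁ x₁ + proj B₂ x₂ := fun x₁ x₂ ↦ by
    have : e.symm ((x₁ : V) + x₂) = (x₁, x₂) := by
      rw [LinearEquiv.symm_apply_eq, Submodule.coe_prodEquivOfIsCompl']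
    rw [hP, LinearEquiv.conj_apply_apply, this, LinearMap.prodMap_apply, Submodule.coe_prodEquivOfIsCompl']
  have hPproj : LinearMap.IsProj (A₁ ⊔ A₂) P := by
    constructor
    · intro x
      obtain ⟨x₁, x₂, rfl⟩ : ∃ (x₁ : V₁) (x₂ : V₂), x = x₁ + x₂ :=
        ⟨(e.symm x).1, (e.symm x).2, by
          rw [← Submodule.coe_prodEquivOfIsCompl' (p := V₁) (q := V₂) hc, LinearEquiv.apply_symm_apply]⟩
      rw [hPapply]
      exact Submodule.add_mem_sup (hp₁.map_mem x₁) (hp₂.map_mem x₂)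
    · intro x hx
      obtain ⟨a₁, ha₁, a₂, ha₂, rfl⟩ := Submodule.mem_sup.1 hx
      have := hPapply ⟨a₁, hA₁ ha₁⟩ ⟨a₂, hA₂ ha₂⟩
      simp only at this
      rw [this, hp₁.map_id _ (show (⟨a₁, hA₁ ha₁⟩ : V₁) ∈ B₁ from ha₁),
        hp₂.map_id _ (show (⟨a₂, hA₂ ha₂⟩ : V₂) ∈ B₂ from ha₂)]
  have hcf₁ : Commute (f.restrict hf₁) (g.restrict hg₁) := LinearMap.restrict_commute hfg _ _
  have hcf₂ : Commute (f.restrict hf₂) (g.restrict hg₂) := LinearMap.restrict_commute hfg _ _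
  rw [res_eq_fpTrace_of_isProj hPproj hf hg hfg, res, res,
    ← fpTrace_prodMap (inE₀_res_comm hp₁ hf₁' hg₁' hcf₁).isFinitePotent
      (inE₀_res_comm hp₂ hf₂' hg₂' hcf₂).isFinitePotent, ← fpTrace_conj e]
  congr 1
  apply (LinearEquiv.conj e.symm).injective
  have hfc : e.symm.conj f = (f.restrict hf₁).prodMap (f.restrict hf₂) := by
    conv_lhs => rw [← conj_prodMap_restrict hc hf₁ hf₂ (θ := f)]
    exact LinearEquiv.conj_symm_conj _ _
  have hgc : e.symm.conj g = (g.restrict hg₁).prodMap (g.restrict hg₂) := by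
    conv_lhs => rw [← conj_prodMap_restrict hc hg₁ hg₂ (θ := g)]
    exact LinearEquiv.conj_symm_conj _ _
  have hPc : e.symm.conj P = (proj B₁).prodMap (proj B₂) := by
    rw [hP]; exact LinearEquiv.conj_symm_conj _ _
  rw [LinearEquiv.conj_symm_conj]
  simp only [Module.End.mul_eq_comp, map_sub, LinearEquiv.conj_comp, hfc, hgc, hPc,
    LinearMap.prodMap_comp]
  ext ⟨x₁, x₂⟩ <;> simp

end isCompl

/-! ### The abstract residue theorem (Tate 1968, §3, Thm. 3 and its Corollary) -/

section residueTheorem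

/-- A complement of `C ⊆ A` inside `A`. [folklore] -/
theorem exists_compl_le {C : Submodule K V} (hCA : C ≤ A) :
    ∃ A₁ : Submodule K V, A₁ ≤ A ∧ Disjoint C A₁ ∧ C ⊔ A₁ = A := by
  obtain ⟨D, hD⟩ := (C.comap A.subtype).exists_isCompl
  refine ⟨D.map A.subtype, Submodule.map_subtype_le A D, ?_, ?_⟩
  · rw [Submodule.disjoint_def]
    rintro x hxC ⟨y, hyD, rfl⟩
    have : y ∈ C.comap A.subtype ⊓ D := ⟨hxC, hyD⟩
    rw [hD.inf_eq_bot, Submodule.mem_bot] at this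
    simp [this]
  · refine le_antisymm (sup_le hCA (Submodule.map_subtype_le A D)) fun a ha ↦ ?_
    have : (⟨a, ha⟩ : A) ∈ C.comap A.subtype ⊔ D := by rw [hD.sup_eq_top]; trivial
    obtain ⟨c, hc, d, hd, hcd⟩ := Submodule.mem_sup.1 this
    rw [← Subtype.coe_inj, Submodule.coe_add] at hcd
    exact Submodule.mem_sup.2 ⟨c, hc, d, ⟨d, hd, rfl⟩, hcd⟩

variable {B : Submodule K V}

/-- **Abstract residue theorem.** Let `f, g ∈ E(A)` commute and let `B ⊆ V` be a subspace invariant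
under `f` and `g` (e.g. a `K[f, g]`-submodule) which is a *quasi-complement* of `A`: `A ∩ B` is
finite-dimensional and `A + B` has finite codimension. Then `res_A(f dg) = 0`.

This is Tate 1968, §3, proof of Thm. 3 / Corollary ("`Σ_p res_p(ω) = 0`"): with `V` the adeles of a
function field, `A = A(0)` and `B = F` the principal adeles, `res_B = 0` because `B` is invariant
(R2), `res_{A+B} = 0` and `res_{A∩B} = 0` because `A + B ∼ V` and `A ∩ B ∼ 0`, and
`res_A + res_B = res_{A+B} + res_{A∩B}` (R5). Here the four-term identity is short-cut: choosing the
projections `π_A` (onto `A` along `B₁ ⊕ D`) and `π_B` (onto `B` along `A₁ ⊕ D`) adapted to a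
decomposition `V = (A ∩ B) ⊕ A₁ ⊕ B₁ ⊕ D`, the operator `π_A + π_B - 1` has finite rank, so
`[π_A f, g] = [φf, g] - [π_B f, g]` with `φ` of finite rank and `[π_B f, g]` of square zero.
[cite: Tate1968, §3, Thm. 3, Corollary] -/
theorem res_eq_zero_of_quasiCompl (hf : InE A f) (hg : InE A g) (hfg : Commute f g)
    (hfB : B.map f ≤ B) (hgB : B.map g ≤ B) [FiniteDimensional K ↥(A ⊓ B)]
    (hAB : NearlyLE ⊤ (A ⊔ B)) : res A f g = 0 := by
  -- the decomposition V = (A ⊓ B) ⊕ A₁ ⊕ B₁ ⊕ D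
  obtain ⟨A₁, hA₁A, hA₁d, hA₁s⟩ := exists_compl_le (inf_le_left : A ⊓ B ≤ A)
  obtain ⟨B₁, hB₁B, hB₁d, hB₁s⟩ := exists_compl_le (inf_le_right : A ⊓ B ≤ B)
  obtain ⟨W, hW, hVW⟩ := hAB
  obtain ⟨D, hDle, hDd, hDs⟩ := exists_compl_le (le_sup_left : A ⊔ B ≤ (A ⊔ B) ⊔ W)
  have hTop : (A ⊔ B) ⊔ D = ⊤ := by rw [hDs]; exact top_le_iff.1 hVW
  haveI : FiniteDimensional K D := by
    -- D is a complement of A ⊔ B inside (A ⊔ B) ⊔ W, as is a complement of (A ⊔ B) ⊓ W in W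
    obtain ⟨W₁, hW₁W, hW₁d, hW₁s⟩ := exists_compl_le (inf_le_right : (A ⊔ B) ⊓ W ≤ W)
    haveI : FiniteDimensional K W₁ := Submodule.finiteDimensional_of_le hW₁W
    refine (finrank_eq_of_compl_eq (A := (A ⊔ B) ⊔ W) (B := A ⊔ B) (C := W₁) (C' := D)
      (hW₁W.trans le_sup_right) ?_ ?_ hDle hDd.symm (by rwa [sup_comm])).1
    · rw [Submodule.disjoint_def] at hW₁d ⊢
      exact fun x hx₁ hx₂ ↦ hW₁d x ⟨hx₂, hW₁W hx₁⟩ hx₁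
    · apply le_antisymm (sup_le (hW₁W.trans le_sup_right) le_sup_left)
      rw [sup_comm W₁]
      refine sup_le le_sup_left ?_
      calc W = (A ⊔ B) ⊓ W ⊔ W₁ := hW₁s.symm
        _ ≤ _ := sup_le (inf_le_left.trans le_sup_left) le_sup_right
  -- π_A : projection onto A along B₁ ⊔ D
  have key : ∀ {A B A₁ B₁ : Submodule K V}, A₁ ≤ A → Disjoint (A ⊓ B) A₁ → A ⊓ B ⊔ A₁ = A →
      B₁ ≤ B → Disjoint (A ⊓ B) B₁ → A ⊓ B ⊔ B₁ = B → (A ⊔ B) ⊔ D = ⊤ → Disjoint (A ⊔ B) D →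
      IsCompl A (B₁ ⊔ D) := by
    intro A B A₁ B₁ hA₁A hA₁d hA₁s hB₁B hB₁d hB₁s hTop hDd
    constructor
    · rw [Submodule.disjoint_def]
      intro a ha hbd
      obtain ⟨b, hb, d, hd, rfl⟩ := Submodule.mem_sup.1 hbd
      have hd0 : d ∈ (A ⊔ B) ⊓ D := ⟨by
        have : b + d - b ∈ A ⊔ B := Submodule.sub_mem _ (Submodule.mem_sup_left ha)
          (Submodule.mem_sup_right (hB₁B hb))
        simpa using this, hd⟩
      rw [hDd.eq_bot, Submodule.mem_bot] at hd0
      subst hd0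
      rw [add_zero] at ha ⊢
      have : b ∈ A ⊓ B ⊓ B₁ := ⟨⟨ha, hB₁B hb⟩, hb⟩
      rwa [hB₁d.eq_bot, Submodule.mem_bot] at this
    · rw [codisjoint_iff, eq_top_iff, ← hTop]
      refine sup_le (sup_le le_sup_left ?_) (le_sup_right.trans le_sup_right)
      rw [← hB₁s]
      exact sup_le (inf_le_left.trans le_sup_left) (le_sup_left.trans le_sup_right)
  have hcA : IsCompl A (B₁ ⊔ D) := key hA₁A hA₁d hA₁s hB₁B hB₁d hB₁s hTop hDd
  have hcB : IsCompl B (A₁ ⊔ D) := by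
    refine key hB₁B ?_ ?_ hA₁A ?_ ?_ (by rwa [sup_comm B A]) (by rwa [sup_comm B A]) <;>
      rw [inf_comm B A] <;> assumption
  set πA := A.projection _ hcA with hπA
  set πB := B.projection _ hcB with hπB
  have hpA : LinearMap.IsProj A πA :=
    ⟨fun x ↦ Submodule.projection_apply_mem _ x, fun _ hx ↦ Submodule.projection_apply_of_mem_left _ hx⟩
  have hpB : LinearMap.IsProj B πB :=
    ⟨fun x ↦ Submodule.projection_apply_mem _ x, fun _ hx ↦ Submodule.projection_apply_of_mem_left _ hx⟩
  -- φ := πA + πB - 1 kills A₁ ⊔ B₁, hence has finite rank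
  set φ := πA + πB - 1 with hφ
  have hφA₁ : ∀ x ∈ A₁, φ x = 0 := fun x hx ↦ by
    have h1 : πA x = x := hpA.map_id x (hA₁A hx)
    have h2 : πB x = 0 := (Submodule.projection_apply_eq_zero_iff hcB).2 (Submodule.mem_sup_left hx)
    change πA x + πB x - x = 0
    rw [h1, h2, add_zero, sub_self]
  have hφB₁ : ∀ x ∈ B₁, φ x = 0 := fun x hx ↦ by
    have h1 : πB x = x := hpB.map_id x (hB₁B hx)
    have h2 : πA x = 0 := (Submodule.projection_apply_eq_zero_iff hcA).2 (Submodule.mem_sup_left hx)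
    change πA x + πB x - x = 0
    rw [h1, h2, zero_add, sub_self]
  haveI hφfin : FiniteDimensional K (range φ) := by
    have : range φ ≤ (A ⊓ B ⊔ D).map φ := by
      rintro _ ⟨v, rfl⟩
      have hv : v ∈ (A₁ ⊔ B₁) ⊔ (A ⊓ B ⊔ D) := by
        have hle : (A ⊔ B) ⊔ D ≤ (A₁ ⊔ B₁) ⊔ (A ⊓ B ⊔ D) := by
          refine sup_le (sup_le ?_ ?_) (le_sup_right.trans le_sup_right)
          · calc A = A ⊓ B ⊔ A₁ := hA₁s.symm
              _ ≤ _ := sup_le (le_sup_left.trans le_sup_right) (le_sup_left.trans le_sup_left)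
          · calc B = A ⊓ B ⊔ B₁ := hB₁s.symm
              _ ≤ _ := sup_le (le_sup_left.trans le_sup_right) (le_sup_right.trans le_sup_left)
        exact hle (hTop.symm ▸ Submodule.mem_top)
      obtain ⟨y, hy, z, hz, rfl⟩ := Submodule.mem_sup.1 hv
      obtain ⟨a₁, ha₁, b₁, hb₁, rfl⟩ := Submodule.mem_sup.1 hy
      refine ⟨z, hz, ?_⟩
      rw [map_add, map_add, hφA₁ a₁ ha₁, hφB₁ b₁ hb₁, zero_add, zero_add]
    exact Submodule.finiteDimensional_of_le this
  -- the operators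
  set TA := πA * f * g - g * (πA * f) with hTA
  set TB := πB * f * g - g * (πB * f) with hTB
  set Tφ := φ * f * g - g * (φ * f) with hTφ
  have hident : TA = Tφ - TB := by
    have h' : TA = Tφ - TB + (f * g - g * f) := by simp only [hTA, hTB, hTφ, hφ]; noncomm_ring
    rw [h', hfg.eq, sub_self, add_zero]
  have h₂ : B.map (f * g) ≤ B := by
    rw [Module.End.mul_eq_comp, Submodule.map_comp]; exact (Submodule.map_mono hgB).trans hfB
  have h₃ : B.map (f * g * g) ≤ B := by
    rw [Module.End.mul_eq_comp, Submodule.map_comp]; exact (Submodule.map_mono hgB).trans h₂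
  have hTB2 : TB * TB = 0 := comm_proj_mul_self hpB hfg hfB h₂ h₃
  -- finite-rank bookkeeping
  set R := range φ ⊔ (range φ).map g with hR
  have hr₁ : range (φ * f * g) ≤ range φ := by
    rw [mul_assoc]; exact range_comp_le_range _ _
  have hr₂ : range (g * (φ * f)) ≤ (range φ).map g := by
    rw [Module.End.mul_eq_comp, range_comp]; exact Submodule.map_mono (range_comp_le_range _ _)
  haveI : FiniteDimensional K (range (φ * f * g)) := Submodule.finiteDimensional_of_le hr₁
  haveI : FiniteDimensional K (range (g * (φ * f))) := Submodule.finiteDimensional_of_le hr₂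
  have hSφ₁ : SmallOn R (φ * f * g) := SmallOn.of_finiteDimensional_range (hr₁.trans le_sup_left)
  have hSφ₂ : SmallOn R (g * (φ * f)) := SmallOn.of_finiteDimensional_range (hr₂.trans le_sup_right)
  have hTφR : range Tφ ≤ R := (hSφ₁.sub hSφ₂).range_le
  haveI : FiniteDimensional K (range Tφ) := Submodule.finiteDimensional_of_le hTφR
  -- both pieces are (B ⊔ R)-small
  have hSB : SmallOn (B ⊔ R) TB := by
    refine ⟨?_, ?_⟩
    · rintro _ ⟨v, rfl⟩
      refine Submodule.mem_sup_left (Submodule.sub_mem _ (hpB.map_mem _) (hgB ⟨_, hpB.map_mem _, rfl⟩))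
    · have hBmap : B.map TB = ⊥ := by
        rw [eq_bot_iff]
        rintro _ ⟨b, hb, rfl⟩
        rw [Submodule.mem_bot]
        exact comm_proj_apply_eq_zero hpB hfg hfB h₂ b hb
      rw [Submodule.map_sup, hBmap, bot_sup_eq]; infer_instance
  have hSφ : SmallOn (B ⊔ R) Tφ := SmallOn.of_finiteDimensional_range (hTφR.trans le_sup_right)
  have hTBtr : fpTrace TB = 0 := fpTrace_eq_zero_of_isNilpotent ⟨2, by rw [pow_two, hTB2]⟩
  have hTφtr : fpTrace Tφ = 0 := by
    rw [hTφ, hSφ₁.fpTrace_sub hSφ₂,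
      Literature.LinearAlgebra.TateResidue.Tate.fpTrace_mul_comm (IsFinitePotent.of_finiteDimensional_range _), sub_self]
  rw [res_eq_fpTrace_of_isProj hpA hf hg hfg, ← hTA, hident, hSφ.fpTrace_sub hSB, hTBtr, hTφtr,
    sub_zero]

end residueTheorem

end res

end Literature.LinearAlgebra.TateResidue.Tate
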